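/-
Origin: expansion seat `planner-pub-hodgecm-mc-axioms-1-g14-0`, handover #W226 2026-08-20T15:53:55Z md5 701436e16329 (PKG bfba5a9cebb3 → 701436e16329; 297 l.; MECHANICAL (iib-R) rewrite v3.1 of the PKG file as it stands (104 token edits; rules R1x1+RX[h₂]x103)) (`HOME/mc/pub-hodgecm-mc-axioms-1-g14/revendor/kit-r55/stage55/HodgeCM/Model/Binders/Real34PinsTotalPK.lean`, md5 701436e16329, 297 lines);
landed by the gen-22 packager (p-g22) in gate run 55 REPLACES the earlier landed copy of `HodgeCM/Model/Binders/Real34PinsTotalPK.lean` (seat copy carried the packager Origin header of an earlier run (stripped)).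
-/
/-
Origin: speedrun cell pub-hodgecm, MODEL-CONSTRUCTION sub-cell, unit pub-hodgecm-mc-binder-1-g11 (BINDER PROVER, gen 11; S RE-PIN P2 of K34-PLAN §3),
seat prover-pub-hodgecm-mc-binder-1-g11-0, 2026-08-20.  Target in PKG: HodgeCM/Model/Binders/Real34PinsTotalPK.lean (NEW additive leaf = the row-15
content of #28 r2 `Real34PinsTotalK` §2/§3′, #29 `Real34PinsTotalKA` §1 and #30 `Real34PinsTotalKCensus` §3 RE-TYPED at sinst-1's PREDICATE-GUARDED
S pin `SInstance.SGP @G @hG @hGR @η @hη @hηc @hGR₀..₃ @AG` exactly as #36 `Gen12PinsTotalP` re-typed #26 (`hdef ↦ hg : G V c`, `A V c ↦ AG V c hg`,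
`SeesawHyp34.ofTotal ↦ .ofGuarded`, `Gen12Pins.X ↦ Gen12PinsP.X`), PLUS the POINTWISE producers `real34_totalKAt` / `real34_totalKTAt` /
`real34_totalKSAt` (per good context under the guard; (L3) `hcorr` and the universe facts discharged) that a pointwise-guarded E child consumes.
Imports #36 (this lineage, RUN 43) + #31 r2 (RUN 39).  KERNEL ONLY; ONE hypothesis record re-instantiated (`Gen12PinsP.Real34CensusSide`, nothing
asserted), 0 records of published theorems, nothing cited, 0 `def … : Prop`, MODEL-N ±0, E unchanged.  Nothing here is a claim of the manuscripts
under adjudication.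
-/
import Summits.HodgeConjecture.HodgeCM.Model.Binders.Gen12PinsTotalP_2
import Summits.HodgeConjecture.HodgeCM.Model.Binders.Real34PinsTotalKSA

/-!
# Row `real34` at the GUARDED pins `(Gen12Pins.Wg …, SInstance.SGP @G @hG … @AG)` — per good context, under the guard

#36 `Binders/Gen12PinsTotalP` re-typed #26 at the predicate-guarded S pin and left row 15 as `real34_total (R : Real34GuardedResidual …)`.
This leaf re-types the three reductions of the residual that #28 r2 / #29 / #30 proved at the total pin `SInstance.S`:

* § 1 `hU_total` (C3₂,₃ from E's `h31` + `hLiu`, glue-1 `thetaSub_of_fact`), `hW_total` (regime of the W-plane at a good context),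
  `hcorr_total` ((L3), theta-3's pin field — ANY side, no guard);
* § 2 under the guard `hg : G V c`: `gen_mem_totalK hg … (D : Real34KTypeDatum …)` (#28 § 2), `gen_mem_totalKT hg … (DT : Real34KTypeDatumT …)`
  (#28 r2 § 3′), the census-side record `Gen12PinsP.Real34CensusSide` (= #30's, re-instantiated: binder-2's (34) census core at the W pin ⊕ `hwedge`
  over `adm₃₄`-admissible frames of lines 2, 3 OF THE GUARDED S PIN) and `gen_mem_totalKS hg … (CS : Real34CensusSide …)` (#30 § 3);
* § 3 **POINTWISE producers** (the shape a pointwise-guarded E child — `S := SInstance.SROG`, bit `orientBitι L ι₁` — applies on its honest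
  branch; cf. #36 `gen12_totalAt`): at a good context `(V, c)` with `hg : G V c`, regime `hV`, the line-weight read-back `hAw` at `k = 2, 3`
  and C3₂,₃ `hU₂ hU₃` AT THAT CONTEXT, each of `D` / `DT` / `CS` gives `Nonempty ((pinT …).Real34FunBridge V c)` —
  **`real34_totalKAt`**, **`real34_totalKTAt`**, **`real34_totalKSAt`**; (L3) `hcorr` is DISCHARGED (`ThetaAdelicSide.exists_corrector_of_mem_levelImage`,
  any side) and so are the universe facts `Fact_pull_comp/_cup/_hodge` (`Model.modelAxiomsPerL`, as in #31 r2 `…₀`).  Proof = g8 #19 r2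
  `Real34PinJunctions.toJunctions` ∘ kit #15 `Real34Junctions.funBridge`, which read their junction record ONLY at the context.
The family-level forms of #28–#31 (`real34_totalK/KT/KS(E)`, hypotheses `hGc : GoodCtx → G V c`) are NOT re-typed: at the guard of record
`SInstance.GOG` (canonical representative ∧ good context) `G V c` is not a consequence of `GoodCtx` alone, and the E child is pointwise.
-/

set_option autoImplicit false

noncomputable section

open MeasureTheory NumberField MulAction
open scoped Matrix InnerProductSpace

namespace HodgeCM.Model

open HodgeCM HodgeCM.Universe HodgeCM.Adelic HodgeCM.Model.HypCensus
open HodgeCM.PerL34 HodgeCM.PerL34.Fock HodgeCM.PerL34.Fock.PrintDict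
open Literature.NumberTheory.Weil1964
open Literature.NumberTheory.Automorphic (piSchwartzBruhat)
open Literature.NumberTheory.Automorphic.UnitaryGroup (archIsotropy archIsotropyProj archKappa archSectionU21CM)
open Literature.NumberTheory.GelbartRogawski1991.UnitaryDualPair
open Literature.RepresentationTheory.HeisenbergGroup
open Literature.Geometry.ComplexHyperbolic.BallModel (U21 x₀ Jac)
open Literature.AlgebraicGeometry.HodgeTheory
open Literature.NumberTheory.Automorphic.PicardCM
open Literature.NumberTheory.Transcendental (Arapura2012_Cor_15_4_6)
open HodgeCM.CMTypeOps (inflate)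
open HodgeCM.Model.ThetaSpace
open HodgeCM.Model.ArchSideTerm
open NumberField.SeesawTorus (charFst charSnd mem_allowedChars)

namespace Gen12PinsP

variable
  (G : ∀ {L : CMField} {ι₁ : L →+* ℂ} (_V : HermSpace3 L ι₁) (_c : SeesawCtx L), Prop)
  (hG : ∀ {L : CMField} {ι₁ : L →+* ℂ} (V : HermSpace3 L ι₁) (c : SeesawCtx L),
    G V c → (∀ j, 0 < (ι₁ (dW c.D j)).re) ∨ ∀ j, (ι₁ (dW c.D j)).re < 0)
  (hGR : ∀ {L : CMField} {ι₁ : L →+* ℂ} (V : HermSpace3 L ι₁) (c : SeesawCtx L),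
    (cmSplittingDatum (L : Type) finProdFinEquiv (frameD V) (frameD_real V) (frameD_ne V) (dW c.D) (dW_real c.D)
      (dW_ne c.D)).CompatibleSplitting)
  (η : ∀ {L : CMField} {ι₁ : L →+* ℂ} (V : HermSpace3 L ι₁) (c : SeesawCtx L),
    CMAdelic (L : Type) (frameD V) × CMAdelic (L : Type) (dW c.D) →* ℂˣ)
  (hη : ∀ {L : CMField} {ι₁ : L →+* ℂ} (V : HermSpace3 L ι₁) (c : SeesawCtx L),
    ∀ γU ∈ CMRat (L : Type) (frameD V), ∀ γ ∈ CMRat (L : Type) (dW c.D), η V c (γU, γ) = 1)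
  (hηc : ∀ {L : CMField} {ι₁ : L →+* ℂ} (V : HermSpace3 L ι₁) (c : SeesawCtx L), Continuous fun p => ((η V c p : ℂˣ) : ℂ))
  (hGR₀ : ∀ {L : CMField} {ι₁ : L →+* ℂ} (V : HermSpace3 L ι₁) (c : SeesawCtx L),
    (cmSplittingDatum (L : Type) (e₁) (frameD V) (frameD_real V) (frameD_ne V) (lineVec (L : Type) (dW c.D 0))
      (fun _ => dW_real c.D 0) (fun _ => dW_ne c.D 0)).CompatibleSplitting)
  (hGR₁ : ∀ {L : CMField} {ι₁ : L →+* ℂ} (V : HermSpace3 L ι₁) (c : SeesawCtx L),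
    (cmSplittingDatum (L : Type) (e₁) (frameD V) (frameD_real V) (frameD_ne V) (lineVec (L : Type) (dW c.D 1))
      (fun _ => dW_real c.D 1) (fun _ => dW_ne c.D 1)).CompatibleSplitting)
  (hGR₂ : ∀ {L : CMField} {ι₁ : L →+* ℂ} (V : HermSpace3 L ι₁) (c : SeesawCtx L),
    (cmSplittingDatum (L : Type) (e₁) (frameD V) (frameD_real V) (frameD_ne V) (lineVec (L : Type) (dW' c.D 0))
      (fun _ => dW'_real c.D 0) (fun _ => dW'_ne c.D 0)).CompatibleSplitting)
  (hGR₃ : ∀ {L : CMField} {ι₁ : L →+* ℂ} (V : HermSpace3 L ι₁) (c : SeesawCtx L),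
    (cmSplittingDatum (L : Type) (e₁) (frameD V) (frameD_real V) (frameD_ne V) (lineVec (L : Type) (dW' c.D 1))
      (fun _ => dW'_real c.D 1) (fun _ => dW'_ne c.D 1)).CompatibleSplitting)
  (AG : ∀ {L : CMField} {ι₁ : L →+* ℂ} (V : HermSpace3 L ι₁) (c : SeesawCtx L), G V c → ∀ k : Fin 4,
    ArchLineInput V (lineRepD V c.D (hGR V c) (hGR₀ V c) (hGR₁ V c) (hGR₂ V c) (hGR₃ V c) (η V c) k))

variable (hHD : exists_isReal_hodgeModel) (hI : hodgePQ_independent_of_hodgeModel)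
  (h₁ : BallQuotientUniformised)  (h₃ : CMAbelianVarietyRealised)
  (h : Bool) (hA : Arapura2012_Cor_15_4_6) (μ : ∀ {L : CMField}, SeesawCtx L → Fin 4 → InfinitePlace L → ℤ)

/- pins spelled out below: W := `Gen12Pins.Wg @hGR @η @hη @hηc @Gen12Pins.τSyl @Gen12Pins.TSyl @Gen12Pins.hTSyl`,
   S := `SInstance.SGP @G @hG @hGR @η @hη @hηc @hGR₀ @hGR₁ @hGR₂ @hGR₃ @AG` (no local notation over section variables, kit #7 GOTCHA). -/

/-! ## 1. C3, the W-regime and (L3) at the guarded pins -/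

/-- **C3 at the guarded pins from E's own binders** (#28 `Gen12Pins.hU_total` re-typed): for every type `i` and level `Γ`, the pinned theta
classes lie in the `(c.K, Ψ_i, σ)`-isotypic part, from `hLiu` (isotypy up to CM-inflation) and the CM-inflation fact `h31` (glue-1's
`Model.thetaSub_of_fact` at `W := Gen12Pins.Wg …`, `X := thetaSpaceInputOf … (SInstance.SGP …)`).  No guard. -/
theorem hU_total (h31 : (picardCMUniverse hHD hI h₁ h₃).Fact_cmInflation)
    (hLiu : ∀ {L : CMField} {ι₁ : L →+* ℂ} (V : HermSpace3 L ι₁) (c : SeesawCtx L),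
      (pinT hHD hI h₁ h₃ h hA (Gen12Pins.Wg @hGR @η @hη @hηc @Gen12Pins.τSyl @Gen12Pins.TSyl @Gen12Pins.hTSyl) (SInstance.SGP @G @hG @hGR @η @hη @hηc @hGR₀ @hGR₁ @hGR₂ @hGR₃ @AG) μ).GoodCtx ι₁ c → Module.finrank ℚ c.K = 6 →
      ∀ (i : Fin 4) (Γ : Level V), ∃ (M : CMField) (k : c.K →+* M) (σ' : M →+* ℂ), σ'.comp k = c.σ ∧
        (pinT hHD hI h₁ h₃ h hA (Gen12Pins.Wg @hGR @η @hη @hηc @Gen12Pins.τSyl @Gen12Pins.TSyl @Gen12Pins.hTSyl) (SInstance.SGP @G @hG @hGR @η @hη @hηc @hGR₀ @hGR₁ @hGR₂ @hGR₃ @AG) μ).Theta V c i Γ ⊆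
          (picardCMUniverse hHD hI h₁ h₃).Uiso Γ M (inflate k (c.Ψ i)) σ')
    {L : CMField} {ι₁ : L →+* ℂ} (V : HermSpace3 L ι₁) (c : SeesawCtx L)
    (hc : (pinT hHD hI h₁ h₃ h hA (Gen12Pins.Wg @hGR @η @hη @hηc @Gen12Pins.τSyl @Gen12Pins.TSyl @Gen12Pins.hTSyl) (SInstance.SGP @G @hG @hGR @η @hη @hηc @hGR₀ @hGR₁ @hGR₂ @hGR₃ @AG) μ).GoodCtx ι₁ c) (hK : Module.finrank ℚ c.K = 6)
    (i : Fin 4) (Γ : Level V) :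
    (pinT hHD hI h₁ h₃ h hA (Gen12Pins.Wg @hGR @η @hη @hηc @Gen12Pins.τSyl @Gen12Pins.TSyl @Gen12Pins.hTSyl) (SInstance.SGP @G @hG @hGR @η @hη @hηc @hGR₀ @hGR₁ @hGR₂ @hGR₃ @AG) μ).Theta V c i Γ ⊆
      (picardCMUniverse hHD hI h₁ h₃).Uiso Γ c.K (c.Ψ i) c.σ :=
  thetaSub_of_fact hHD hI h₁ h₃ h hA (Gen12Pins.Wg @hGR @η @hη @hηc @Gen12Pins.τSyl @Gen12Pins.TSyl @Gen12Pins.hTSyl)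
    (fun V c => thetaSpaceInputOf hHD hI h₁ h₃ (SInstance.SGP @G @hG @hGR @η @hη @hηc @hGR₀ @hGR₁ @hGR₂ @hGR₃ @AG) V c) μ h31 hLiu V c hc hK i Γ

/-- the regime of the W-plane at a good context of the pinned END STATE (#28 `Gen12Pins.hW_total` re-typed; no guard). -/
theorem hW_total {L : CMField} {ι₁ : L →+* ℂ} (c : SeesawCtx L)
    (hc : (pinT hHD hI h₁ h₃ h hA (Gen12Pins.Wg @hGR @η @hη @hηc @Gen12Pins.τSyl @Gen12Pins.TSyl @Gen12Pins.hTSyl) (SInstance.SGP @G @hG @hGR @η @hη @hηc @hGR₀ @hGR₁ @hGR₂ @hGR₃ @AG) μ).GoodCtx ι₁ c) :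
    IsAnisotropic L c.D.gramW :=
  AdelicThetaCore.isAnisotropic_gramW_of_goodCtx
    (pinC hHD hI h₁ h₃ hA (Gen12Pins.Wg @hGR @η @hη @hηc @Gen12Pins.τSyl @Gen12Pins.TSyl @Gen12Pins.hTSyl) (SInstance.SGP @G @hG @hGR @η @hη @hηc @hGR₀ @hGR₁ @hGR₂ @hGR₃ @AG)) h (d12Of μ) (d34Of μ)
    ((pinT_eq_thetaModel hHD hI h₁ h₃ h hA (Gen12Pins.Wg @hGR @η @hη @hηc @Gen12Pins.τSyl @Gen12Pins.TSyl @Gen12Pins.hTSyl) (SInstance.SGP @G @hG @hGR @η @hη @hηc @hGR₀ @hGR₁ @hGR₂ @hGR₃ @AG) μ) ▸ hc)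

/-- **(L3) `hcorr` at the guarded S pin, DISCHARGED** (#29 `Gen12Pins.hcorr_total` re-typed: theta-3 (A) pin field `ThetaAdelicSide.rat_split_level`
through `ThetaAdelicSide.exists_corrector_of_mem_levelImage`; holds for EVERY `ThetaAdelicSide`, no guard). -/
theorem hcorr_total {L : CMField} {ι₁ : L →+* ℂ} (V : HermSpace3 L ι₁) (c : SeesawCtx L) (hV : IsAnisotropic L V.Hm) :
    ∀ (Γ : Level V), ∀ δ ∈ levelImage hHD hI h₁ h₃ Γ hV,
      ∃ x : (V.latticeModel printFact_unitaryCompact_holds).G, x ∈ satLevelRegimeOf V hV Γ.K ∧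
        ((SInstance.SGP @G @hG @hGR @η @hη @hηc @hGR₀ @hGR₁ @hGR₂ @hGR₃ @AG) V c).ιinf δ * x ∈ (V.latticeModel printFact_unitaryCompact_holds).Γ ∧
          ∀ y : U21, Commute x (((SInstance.SGP @G @hG @hGR @η @hη @hηc @hGR₀ @hGR₁ @hGR₂ @hGR₃ @AG) V c).ιinf y) :=
  fun Γ => ((SInstance.SGP @G @hG @hGR @η @hη @hηc @hGR₀ @hGR₁ @hGR₂ @hGR₃ @AG) V c).exists_corrector_of_mem_levelImage hHD hI h₁ h₃ Γ hV

/-! ## 2. (K34) at the guarded pins, under the guard: from `D`, from `DT`, from a census side `CS` -/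

section Context34

variable {L : CMField} {ι₁ : L →+* ℂ} (V : HermSpace3 L ι₁) (c : SeesawCtx L) (hV : IsAnisotropic L V.Hm)

local notation3 "L⁺" => maximalRealSubfield (L : Type)

/-- **(K34) at the guarded pins from the K-type datum** (#28 `gen_mem_totalK` re-typed): `gen_mem` at the wset of the pinned record (on
`hGfin_total hg` and `hcorr`) from the regime `hW`, the line-weight read-back `hAw` at `k = 2, 3` and ONE `Real34KTypeDatum` (at
`H := SeesawHyp34.ofGuarded hg`, `adm := adm₃₄`) — #28 § 1 with `h2`/`h3 := (ST_P_w hg k).trans (hAw k)`. -/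
theorem gen_mem_totalK (hg : G V c)
    (hcorr : ∀ (Γ : Level V), ∀ δ ∈ levelImage hHD hI h₁ h₃ Γ hV,
      ∃ x : (V.latticeModel printFact_unitaryCompact_holds).G, x ∈ satLevelRegimeOf V hV Γ.K ∧
        ((SInstance.SGP @G @hG @hGR @η @hη @hηc @hGR₀ @hGR₁ @hGR₂ @hGR₃ @AG) V c).ιinf δ * x ∈ (V.latticeModel printFact_unitaryCompact_holds).Γ ∧ ∀ y : U21, Commute x (((SInstance.SGP @G @hG @hGR @η @hη @hηc @hGR₀ @hGR₁ @hGR₂ @hGR₃ @AG) V c).ιinf y))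
    (hW : IsAnisotropic L c.D.gramW) (hAw : ∀ k : Fin 4, k = 2 ∨ k = 3 → (AG V c hg k).w = ⇑(archWeight L (μ c k)))
    (D : Real34KTypeDatum hHD hI h₁ h₃ h hA (Gen12Pins.Wg @hGR @η @hη @hηc @Gen12Pins.τSyl @Gen12Pins.TSyl @Gen12Pins.hTSyl) (SInstance.SGP @G @hG @hGR @η @hη @hηc @hGR₀ @hGR₁ @hGR₂ @hGR₃ @AG) μ V c hV
      (SeesawHyp34.ofGuarded @G @hG @hGR @η @hη @hηc @hGR₀ @hGR₁ @hGR₂ @hGR₃ @AG V c hg)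
      (adm₃₄ hHD hI h₁ h₃ ((SInstance.SGP @G @hG @hGR @η @hη @hηc @hGR₀ @hGR₁ @hGR₂ @hGR₃ @AG) V c) hV)) :
    ∀ (χ : ((pinT hHD hI h₁ h₃ h hA (Gen12Pins.Wg @hGR @η @hη @hηc @Gen12Pins.τSyl @Gen12Pins.TSyl @Gen12Pins.hTSyl) (SInstance.SGP @G @hG @hGR @η @hη @hηc @hGR₀ @hGR₁ @hGR₂ @hGR₃ @AG) μ).t34 V c).X)
      (Φ : (pinT hHD hI h₁ h₃ h hA (Gen12Pins.Wg @hGR @η @hη @hηc @Gen12Pins.τSyl @Gen12Pins.TSyl @Gen12Pins.hTSyl) (SInstance.SGP @G @hG @hGR @η @hη @hηc @hGR₀ @hGR₁ @hGR₂ @hGR₃ @AG) μ).SK V c),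
      ((pinT hHD hI h₁ h₃ h hA (Gen12Pins.Wg @hGR @η @hη @hηc @Gen12Pins.τSyl @Gen12Pins.TSyl @Gen12Pins.hTSyl) (SInstance.SGP @G @hG @hGR @η @hη @hηc @hGR₀ @hGR₁ @hGR₂ @hGR₃ @AG) μ).t34 V c).ϑ χ Φ ∈
        (Submodule.span ℂ (Real34Loc.ofThetaSat hHD hI h₁ h₃ h hA (Gen12Pins.Wg @hGR @η @hη @hηc @Gen12Pins.τSyl @Gen12Pins.TSyl @Gen12Pins.hTSyl) (SInstance.SGP @G @hG @hGR @η @hη @hηc @hGR₀ @hGR₁ @hGR₂ @hGR₃ @AG) μ V c hV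
          (hGfin_total @G @hG @hGR @η @hη @hηc @hGR₀ @hGR₁ @hGR₂ @hGR₃ @AG V c hV hg) hcorr).wset).topologicalClosure :=
  Real34Loc.gen_mem_ofThetaSat_of_kTypeDatum hHD hI h₁ h₃ h hA (Gen12Pins.Wg @hGR @η @hη @hηc @Gen12Pins.τSyl @Gen12Pins.TSyl @Gen12Pins.hTSyl) (SInstance.SGP @G @hG @hGR @η @hη @hηc @hGR₀ @hGR₁ @hGR₂ @hGR₃ @AG) μ V c hV
    (hGfin_total @G @hG @hGR @η @hη @hηc @hGR₀ @hGR₁ @hGR₂ @hGR₃ @AG V c hV hg) hcorr hW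
    (SeesawHyp34.ofGuarded @G @hG @hGR @η @hη @hηc @hGR₀ @hGR₁ @hGR₂ @hGR₃ @AG V c hg)
    ((ST_P_w @G @hG @hGR @η @hη @hηc @hGR₀ @hGR₁ @hGR₂ @hGR₃ @AG V c hg 2).trans (hAw 2 (Or.inl rfl)))
    ((ST_P_w @G @hG @hGR @η @hη @hηc @hGR₀ @hGR₁ @hGR₂ @hGR₃ @AG V c hg 3).trans (hAw 3 (Or.inr rfl))) D

/-- **(K34) at the guarded pins from the CHARACTER-WISE datum** (#28 r2 `gen_mem_totalKT` re-typed; density-free twin of `gen_mem_totalK`). -/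
theorem gen_mem_totalKT (hg : G V c)
    (hcorr : ∀ (Γ : Level V), ∀ δ ∈ levelImage hHD hI h₁ h₃ Γ hV,
      ∃ x : (V.latticeModel printFact_unitaryCompact_holds).G, x ∈ satLevelRegimeOf V hV Γ.K ∧
        ((SInstance.SGP @G @hG @hGR @η @hη @hηc @hGR₀ @hGR₁ @hGR₂ @hGR₃ @AG) V c).ιinf δ * x ∈ (V.latticeModel printFact_unitaryCompact_holds).Γ ∧ ∀ y : U21, Commute x (((SInstance.SGP @G @hG @hGR @η @hη @hηc @hGR₀ @hGR₁ @hGR₂ @hGR₃ @AG) V c).ιinf y))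
    (hW : IsAnisotropic L c.D.gramW) (hAw : ∀ k : Fin 4, k = 2 ∨ k = 3 → (AG V c hg k).w = ⇑(archWeight L (μ c k)))
    (DT : Real34KTypeDatumT hHD hI h₁ h₃ h hA (Gen12Pins.Wg @hGR @η @hη @hηc @Gen12Pins.τSyl @Gen12Pins.TSyl @Gen12Pins.hTSyl) (SInstance.SGP @G @hG @hGR @η @hη @hηc @hGR₀ @hGR₁ @hGR₂ @hGR₃ @AG) μ V c hV
      (SeesawHyp34.ofGuarded @G @hG @hGR @η @hη @hηc @hGR₀ @hGR₁ @hGR₂ @hGR₃ @AG V c hg)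
      (adm₃₄ hHD hI h₁ h₃ ((SInstance.SGP @G @hG @hGR @η @hη @hηc @hGR₀ @hGR₁ @hGR₂ @hGR₃ @AG) V c) hV)) :
    ∀ (χ : ((pinT hHD hI h₁ h₃ h hA (Gen12Pins.Wg @hGR @η @hη @hηc @Gen12Pins.τSyl @Gen12Pins.TSyl @Gen12Pins.hTSyl) (SInstance.SGP @G @hG @hGR @η @hη @hηc @hGR₀ @hGR₁ @hGR₂ @hGR₃ @AG) μ).t34 V c).X)
      (Φ : (pinT hHD hI h₁ h₃ h hA (Gen12Pins.Wg @hGR @η @hη @hηc @Gen12Pins.τSyl @Gen12Pins.TSyl @Gen12Pins.hTSyl) (SInstance.SGP @G @hG @hGR @η @hη @hηc @hGR₀ @hGR₁ @hGR₂ @hGR₃ @AG) μ).SK V c),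
      ((pinT hHD hI h₁ h₃ h hA (Gen12Pins.Wg @hGR @η @hη @hηc @Gen12Pins.τSyl @Gen12Pins.TSyl @Gen12Pins.hTSyl) (SInstance.SGP @G @hG @hGR @η @hη @hηc @hGR₀ @hGR₁ @hGR₂ @hGR₃ @AG) μ).t34 V c).ϑ χ Φ ∈
        (Submodule.span ℂ (Real34Loc.ofThetaSat hHD hI h₁ h₃ h hA (Gen12Pins.Wg @hGR @η @hη @hηc @Gen12Pins.τSyl @Gen12Pins.TSyl @Gen12Pins.hTSyl) (SInstance.SGP @G @hG @hGR @η @hη @hηc @hGR₀ @hGR₁ @hGR₂ @hGR₃ @AG) μ V c hV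
          (hGfin_total @G @hG @hGR @η @hη @hηc @hGR₀ @hGR₁ @hGR₂ @hGR₃ @AG V c hV hg) hcorr).wset).topologicalClosure :=
  Real34Loc.gen_mem_ofThetaSat_of_kTypeDatumT hHD hI h₁ h₃ h hA (Gen12Pins.Wg @hGR @η @hη @hηc @Gen12Pins.τSyl @Gen12Pins.TSyl @Gen12Pins.hTSyl) (SInstance.SGP @G @hG @hGR @η @hη @hηc @hGR₀ @hGR₁ @hGR₂ @hGR₃ @AG) μ V c hV
    (hGfin_total @G @hG @hGR @η @hη @hηc @hGR₀ @hGR₁ @hGR₂ @hGR₃ @AG V c hV hg) hcorr hW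
    (SeesawHyp34.ofGuarded @G @hG @hGR @η @hη @hηc @hGR₀ @hGR₁ @hGR₂ @hGR₃ @AG V c hg)
    ((ST_P_w @G @hG @hGR @η @hη @hηc @hGR₀ @hGR₁ @hGR₂ @hGR₃ @AG V c hg 2).trans (hAw 2 (Or.inl rfl)))
    ((ST_P_w @G @hG @hGR @η @hη @hηc @hGR₀ @hGR₁ @hGR₂ @hGR₃ @AG V c hg 3).trans (hAw 3 (Or.inr rfl))) DT

/-- **The (34) CENSUS SIDE of a context, with the wedge decomposition of its generators** (#30 `Gen12Pins.Real34CensusSide` re-instantiated at the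
guarded S pin): mc-binder-2's `HypCoreW` of the W pin `Gen12Pins.Wg …` for the (34) torus `c.D.jT₃₄` at the (34) exponents `(-μ c 2, -μ c 3)` (THE object
behind E's binder `hyp34` at the pins, `HypCensus/SideE.hyp34_of_sideW`), together with `hwedge`: every inserted printed vector `ins f φ` is a finite sum
of wedge tensors `tau34 φ₂⁰ φ₃¹ − tau34 φ₂¹ φ₃⁰` of frame vectors of `adm₃₄`-admissible situations of lines `2`, `3` OF THE GUARDED S PIN
`SInstance.SGP … V c`.  A HYPOTHESIS record (one census record + one Prop); nothing asserted.  (`hwedge` is S-dependent, the core is not.) -/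
structure Real34CensusSide where
  /-- binder-2's (34) census core of the context at the W pin -/
  core : HypCoreW ((Gen12Pins.Wg @hGR @η @hη @hηc @Gen12Pins.τSyl @Gen12Pins.TSyl @Gen12Pins.hTSyl) V c) c.D.jT₃₄ (fun w => -μ c 2 w) (fun w => -μ c 3 w)
  /-- the wedge decomposition of the inserted printed vectors over admissible frames of lines `2`, `3` of the guarded S pin -/
  hwedge : letI := core.decEq
    ∀ (f : core.side.FinIdx)
      (φ : (printPlaces (InfinitePlace (L : Type)) core.kind core.lam core.hlam (pinnedVacs core.kind (fun w => -μ c 2 w) (fun w => -μ c 3 w))).F),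
      ∃ (n : ℕ) (Γ' : Fin n → Level V)
        (Sit₂ : ∀ i, KTypeSituation ((pinX hHD hI h₁ h₃ (SInstance.SGP @G @hG @hGR @η @hη @hηc @hGR₀ @hGR₁ @hGR₂ @hGR₃ @AG) V c hV).P 2) ((pinX hHD hI h₁ h₃ (SInstance.SGP @G @hG @hGR @η @hη @hηc @hGR₀ @hGR₁ @hGR₂ @hGR₃ @AG) V c hV).ιinf (Γ' i))
          ((pinX hHD hI h₁ h₃ (SInstance.SGP @G @hG @hGR @η @hη @hηc @hGR₀ @hGR₁ @hGR₂ @hGR₃ @AG) V c hV).Δ (Γ' i)) (pinX hHD hI h₁ h₃ (SInstance.SGP @G @hG @hGR @η @hη @hηc @hGR₀ @hGR₁ @hGR₂ @hGR₃ @AG) V c hV).κ₁ (pinX hHD hI h₁ h₃ (SInstance.SGP @G @hG @hGR @η @hη @hηc @hGR₀ @hGR₁ @hGR₂ @hGR₃ @AG) V c hV).τ₁)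
        (j₂ : ∀ i, {j : (Sit₂ i).E →ₗ[ℂ] ((pinX hHD hI h₁ h₃ (SInstance.SGP @G @hG @hGR @η @hη @hηc @hGR₀ @hGR₁ @hGR₂ @hGR₃ @AG) V c hV).P 2).weilDatum.ThetaTop //
          ((pinX hHD hI h₁ h₃ (SInstance.SGP @G @hG @hGR @η @hη @hηc @hGR₀ @hGR₁ @hGR₂ @hGR₃ @AG) V c hV).P 2).kernelDatum.IsThetaEquivariant (Sit₂ i).κ (Sit₂ i).σ j})
        (Sit₃ : ∀ i, KTypeSituation ((pinX hHD hI h₁ h₃ (SInstance.SGP @G @hG @hGR @η @hη @hηc @hGR₀ @hGR₁ @hGR₂ @hGR₃ @AG) V c hV).P 3) ((pinX hHD hI h₁ h₃ (SInstance.SGP @G @hG @hGR @η @hη @hηc @hGR₀ @hGR₁ @hGR₂ @hGR₃ @AG) V c hV).ιinf (Γ' i))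
          ((pinX hHD hI h₁ h₃ (SInstance.SGP @G @hG @hGR @η @hη @hηc @hGR₀ @hGR₁ @hGR₂ @hGR₃ @AG) V c hV).Δ (Γ' i)) (pinX hHD hI h₁ h₃ (SInstance.SGP @G @hG @hGR @η @hη @hηc @hGR₀ @hGR₁ @hGR₂ @hGR₃ @AG) V c hV).κ₁ (pinX hHD hI h₁ h₃ (SInstance.SGP @G @hG @hGR @η @hη @hηc @hGR₀ @hGR₁ @hGR₂ @hGR₃ @AG) V c hV).τ₁)
        (j₃ : ∀ i, {j : (Sit₃ i).E →ₗ[ℂ] ((pinX hHD hI h₁ h₃ (SInstance.SGP @G @hG @hGR @η @hη @hηc @hGR₀ @hGR₁ @hGR₂ @hGR₃ @AG) V c hV).P 3).weilDatum.ThetaTop //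
          ((pinX hHD hI h₁ h₃ (SInstance.SGP @G @hG @hGR @η @hη @hηc @hGR₀ @hGR₁ @hGR₂ @hGR₃ @AG) V c hV).P 3).kernelDatum.IsThetaEquivariant (Sit₃ i).κ (Sit₃ i).σ j})
        (φ₂ φ₃ : Fin n → Fin 2 → piSchwartzBruhat (pinX hHD hI h₁ h₃ (SInstance.SGP @G @hG @hGR @η @hη @hηc @hGR₀ @hGR₁ @hGR₂ @hGR₃ @AG) V c hV).K (Fin 3)) (a : Fin n → ℂ),
        (∀ i, adm₃₄ hHD hI h₁ h₃ ((SInstance.SGP @G @hG @hGR @η @hη @hηc @hGR₀ @hGR₁ @hGR₂ @hGR₃ @AG) V c) hV (Γ' i) 2 (Sit₂ i) ∧ j₂ i ∈ (Sit₂ i).𝓙 ∧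
          adm₃₄ hHD hI h₁ h₃ ((SInstance.SGP @G @hG @hGR @η @hη @hηc @hGR₀ @hGR₁ @hGR₂ @hGR₃ @AG) V c) hV (Γ' i) 3 (Sit₃ i) ∧ j₃ i ∈ (Sit₃ i).𝓙) ∧
        (∀ i a', ((pinX hHD hI h₁ h₃ (SInstance.SGP @G @hG @hGR @η @hη @hηc @hGR₀ @hGR₁ @hGR₂ @hGR₃ @AG) V c hV).P 2).weilDatum.toThetaTop (φ₂ i a') = (j₂ i).1 ((Sit₂ i).ι (LinearMap.proj a'))) ∧
        (∀ i a', ((pinX hHD hI h₁ h₃ (SInstance.SGP @G @hG @hGR @η @hη @hηc @hGR₀ @hGR₁ @hGR₂ @hGR₃ @AG) V c hV).P 3).weilDatum.toThetaTop (φ₃ i a') = (j₃ i).1 ((Sit₃ i).ι (LinearMap.proj a'))) ∧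
        core.side.ins f φ = ∑ i, a i • (tau34 V c.D (φ₂ i 0) (φ₃ i 1) - tau34 V c.D (φ₂ i 1) (φ₃ i 0))

/-- **(K34) at the guarded pins from the (34) census side** (#30 `gen_mem_totalKS` re-typed: #30 § 2 at `W := Gen12Pins.Wg …`, `S := SInstance.SGP …`,
`H := SeesawHyp34.ofGuarded hg`, `h2/h3 := (ST_P_w hg k).trans (hAw k)`). -/
theorem gen_mem_totalKS (hg : G V c)
    (hcorr : ∀ (Γ : Level V), ∀ δ ∈ levelImage hHD hI h₁ h₃ Γ hV,
      ∃ x : (V.latticeModel printFact_unitaryCompact_holds).G, x ∈ satLevelRegimeOf V hV Γ.K ∧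
        ((SInstance.SGP @G @hG @hGR @η @hη @hηc @hGR₀ @hGR₁ @hGR₂ @hGR₃ @AG) V c).ιinf δ * x ∈ (V.latticeModel printFact_unitaryCompact_holds).Γ ∧ ∀ y : U21, Commute x (((SInstance.SGP @G @hG @hGR @η @hη @hηc @hGR₀ @hGR₁ @hGR₂ @hGR₃ @AG) V c).ιinf y))
    (hW : IsAnisotropic L c.D.gramW) (hAw : ∀ k : Fin 4, k = 2 ∨ k = 3 → (AG V c hg k).w = ⇑(archWeight L (μ c k)))
    (CS : Real34CensusSide @G @hG @hGR @η @hη @hηc @hGR₀ @hGR₁ @hGR₂ @hGR₃ @AG hHD hI h₁ h₃ @μ V c hV) :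
    ∀ (χ : ((pinT hHD hI h₁ h₃ h hA (Gen12Pins.Wg @hGR @η @hη @hηc @Gen12Pins.τSyl @Gen12Pins.TSyl @Gen12Pins.hTSyl) (SInstance.SGP @G @hG @hGR @η @hη @hηc @hGR₀ @hGR₁ @hGR₂ @hGR₃ @AG) μ).t34 V c).X) (Φ : (pinT hHD hI h₁ h₃ h hA (Gen12Pins.Wg @hGR @η @hη @hηc @Gen12Pins.τSyl @Gen12Pins.TSyl @Gen12Pins.hTSyl) (SInstance.SGP @G @hG @hGR @η @hη @hηc @hGR₀ @hGR₁ @hGR₂ @hGR₃ @AG) μ).SK V c),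
      ((pinT hHD hI h₁ h₃ h hA (Gen12Pins.Wg @hGR @η @hη @hηc @Gen12Pins.τSyl @Gen12Pins.TSyl @Gen12Pins.hTSyl) (SInstance.SGP @G @hG @hGR @η @hη @hηc @hGR₀ @hGR₁ @hGR₂ @hGR₃ @AG) μ).t34 V c).ϑ χ Φ ∈
        (Submodule.span ℂ (Real34Loc.ofThetaSat hHD hI h₁ h₃ h hA (Gen12Pins.Wg @hGR @η @hη @hηc @Gen12Pins.τSyl @Gen12Pins.TSyl @Gen12Pins.hTSyl) (SInstance.SGP @G @hG @hGR @η @hη @hηc @hGR₀ @hGR₁ @hGR₂ @hGR₃ @AG) μ V c hV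
          (hGfin_total @G @hG @hGR @η @hη @hηc @hGR₀ @hGR₁ @hGR₂ @hGR₃ @AG V c hV hg) hcorr).wset).topologicalClosure := by
  letI := CS.core.decEq
  exact Real34Loc.gen_mem_ofThetaSat_of_sideW hHD hI h₁ h₃ h hA (Gen12Pins.Wg @hGR @η @hη @hηc @Gen12Pins.τSyl @Gen12Pins.TSyl @Gen12Pins.hTSyl) (SInstance.SGP @G @hG @hGR @η @hη @hηc @hGR₀ @hGR₁ @hGR₂ @hGR₃ @AG) μ V c hV (hGfin_total @G @hG @hGR @η @hη @hηc @hGR₀ @hGR₁ @hGR₂ @hGR₃ @AG V c hV hg) hcorr hW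
    (SeesawHyp34.ofGuarded @G @hG @hGR @η @hη @hηc @hGR₀ @hGR₁ @hGR₂ @hGR₃ @AG V c hg)
    ((ST_P_w @G @hG @hGR @η @hη @hηc @hGR₀ @hGR₁ @hGR₂ @hGR₃ @AG V c hg 2).trans (hAw 2 (Or.inl rfl)))
    ((ST_P_w @G @hG @hGR @η @hη @hηc @hGR₀ @hGR₁ @hGR₂ @hGR₃ @AG V c hg 3).trans (hAw 3 (Or.inr rfl)))
    CS.core.kind CS.core.lam CS.core.hlam _ _ CS.core.side CS.hwedge

/-! ## 3. POINTWISE producers of row `real34` under the guard -/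

/-- **Row `real34` PER CONTEXT under the guard, from the K-type datum** (no family-level hypothesis): at a good context `(V, c)` with `hg : G V c`,
regime `hV`, line weights `hAw` at `k = 2, 3` and C3₂,₃ `hU₂ hU₃` AT THAT CONTEXT, ONE `Real34KTypeDatum` gives E's `Real34FunBridge V c` —
g8 `Real34PinJunctions.toJunctions` ∘ kit #15 `Real34Junctions.funBridge` at the residual record `⟨hcorr_total, gen_mem_totalK …, hU₂, hU₃⟩`
((L3) discharged; universe facts by `Model.modelAxiomsPerL`). -/
theorem real34_totalKAt (hg : G V c)
    (hc : (pinT hHD hI h₁ h₃ h hA (Gen12Pins.Wg @hGR @η @hη @hηc @Gen12Pins.τSyl @Gen12Pins.TSyl @Gen12Pins.hTSyl) (SInstance.SGP @G @hG @hGR @η @hη @hηc @hGR₀ @hGR₁ @hGR₂ @hGR₃ @AG) μ).GoodCtx ι₁ c)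
    (hAw : ∀ k : Fin 4, k = 2 ∨ k = 3 → (AG V c hg k).w = ⇑(archWeight L (μ c k)))
    (hU₂ : ∀ Γ : Level V, (pinT hHD hI h₁ h₃ h hA (Gen12Pins.Wg @hGR @η @hη @hηc @Gen12Pins.τSyl @Gen12Pins.TSyl @Gen12Pins.hTSyl) (SInstance.SGP @G @hG @hGR @η @hη @hηc @hGR₀ @hGR₁ @hGR₂ @hGR₃ @AG) μ).Theta V c 2 Γ ⊆ (picardCMUniverse hHD hI h₁ h₃).Uiso Γ c.K (c.Ψ 2) c.σ)
    (hU₃ : ∀ Γ : Level V, (pinT hHD hI h₁ h₃ h hA (Gen12Pins.Wg @hGR @η @hη @hηc @Gen12Pins.τSyl @Gen12Pins.TSyl @Gen12Pins.hTSyl) (SInstance.SGP @G @hG @hGR @η @hη @hηc @hGR₀ @hGR₁ @hGR₂ @hGR₃ @AG) μ).Theta V c 3 Γ ⊆ (picardCMUniverse hHD hI h₁ h₃).Uiso Γ c.K (c.Ψ 3) c.σ)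
    (D : Real34KTypeDatum hHD hI h₁ h₃ h hA (Gen12Pins.Wg @hGR @η @hη @hηc @Gen12Pins.τSyl @Gen12Pins.TSyl @Gen12Pins.hTSyl) (SInstance.SGP @G @hG @hGR @η @hη @hηc @hGR₀ @hGR₁ @hGR₂ @hGR₃ @AG) μ V c hV
      (SeesawHyp34.ofGuarded @G @hG @hGR @η @hη @hηc @hGR₀ @hGR₁ @hGR₂ @hGR₃ @AG V c hg)
      (adm₃₄ hHD hI h₁ h₃ ((SInstance.SGP @G @hG @hGR @η @hη @hηc @hGR₀ @hGR₁ @hGR₂ @hGR₃ @AG) V c) hV)) :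
    Nonempty ((pinT hHD hI h₁ h₃ h hA (Gen12Pins.Wg @hGR @η @hη @hηc @Gen12Pins.τSyl @Gen12Pins.TSyl @Gen12Pins.hTSyl) (SInstance.SGP @G @hG @hGR @η @hη @hηc @hGR₀ @hGR₁ @hGR₂ @hGR₃ @AG) μ).Real34FunBridge V c) :=
  ⟨((⟨hcorr_total @G @hG @hGR @η @hη @hηc @hGR₀ @hGR₁ @hGR₂ @hGR₃ @AG hHD hI h₁ h₃ V c hV,
        gen_mem_totalK @G @hG @hGR @η @hη @hηc @hGR₀ @hGR₁ @hGR₂ @hGR₃ @AG hHD hI h₁ h₃ h hA @μ V c hV hg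
          (hcorr_total @G @hG @hGR @η @hη @hηc @hGR₀ @hGR₁ @hGR₂ @hGR₃ @AG hHD hI h₁ h₃ V c hV)
          (hW_total @G @hG @hGR @η @hη @hηc @hGR₀ @hGR₁ @hGR₂ @hGR₃ @AG hHD hI h₁ h₃ h hA @μ c hc) hAw D,
        hU₂, hU₃⟩ : Real34GuardedResidual @G @hG @hGR @η @hη @hηc @hGR₀ @hGR₁ @hGR₂ @hGR₃ @AG hHD hI h₁ h₃ h hA @μ V c hV hg).toJunctions).toJunctions.funBridge
      (Model.modelAxiomsPerL hHD hI h₃ h₁).pull_comp (Model.modelAxiomsPerL hHD hI h₃ h₁).pull_cup (Model.modelAxiomsPerL hHD hI h₃ h₁).pull_hodge⟩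

/-- **Row `real34` PER CONTEXT under the guard, from the CHARACTER-WISE K-type datum** (density-free twin of `real34_totalKAt`). -/
theorem real34_totalKTAt (hg : G V c)
    (hc : (pinT hHD hI h₁ h₃ h hA (Gen12Pins.Wg @hGR @η @hη @hηc @Gen12Pins.τSyl @Gen12Pins.TSyl @Gen12Pins.hTSyl) (SInstance.SGP @G @hG @hGR @η @hη @hηc @hGR₀ @hGR₁ @hGR₂ @hGR₃ @AG) μ).GoodCtx ι₁ c)
    (hAw : ∀ k : Fin 4, k = 2 ∨ k = 3 → (AG V c hg k).w = ⇑(archWeight L (μ c k)))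
    (hU₂ : ∀ Γ : Level V, (pinT hHD hI h₁ h₃ h hA (Gen12Pins.Wg @hGR @η @hη @hηc @Gen12Pins.τSyl @Gen12Pins.TSyl @Gen12Pins.hTSyl) (SInstance.SGP @G @hG @hGR @η @hη @hηc @hGR₀ @hGR₁ @hGR₂ @hGR₃ @AG) μ).Theta V c 2 Γ ⊆ (picardCMUniverse hHD hI h₁ h₃).Uiso Γ c.K (c.Ψ 2) c.σ)
    (hU₃ : ∀ Γ : Level V, (pinT hHD hI h₁ h₃ h hA (Gen12Pins.Wg @hGR @η @hη @hηc @Gen12Pins.τSyl @Gen12Pins.TSyl @Gen12Pins.hTSyl) (SInstance.SGP @G @hG @hGR @η @hη @hηc @hGR₀ @hGR₁ @hGR₂ @hGR₃ @AG) μ).Theta V c 3 Γ ⊆ (picardCMUniverse hHD hI h₁ h₃).Uiso Γ c.K (c.Ψ 3) c.σ)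
    (DT : Real34KTypeDatumT hHD hI h₁ h₃ h hA (Gen12Pins.Wg @hGR @η @hη @hηc @Gen12Pins.τSyl @Gen12Pins.TSyl @Gen12Pins.hTSyl) (SInstance.SGP @G @hG @hGR @η @hη @hηc @hGR₀ @hGR₁ @hGR₂ @hGR₃ @AG) μ V c hV
      (SeesawHyp34.ofGuarded @G @hG @hGR @η @hη @hηc @hGR₀ @hGR₁ @hGR₂ @hGR₃ @AG V c hg)
      (adm₃₄ hHD hI h₁ h₃ ((SInstance.SGP @G @hG @hGR @η @hη @hηc @hGR₀ @hGR₁ @hGR₂ @hGR₃ @AG) V c) hV)) :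
    Nonempty ((pinT hHD hI h₁ h₃ h hA (Gen12Pins.Wg @hGR @η @hη @hηc @Gen12Pins.τSyl @Gen12Pins.TSyl @Gen12Pins.hTSyl) (SInstance.SGP @G @hG @hGR @η @hη @hηc @hGR₀ @hGR₁ @hGR₂ @hGR₃ @AG) μ).Real34FunBridge V c) :=
  ⟨((⟨hcorr_total @G @hG @hGR @η @hη @hηc @hGR₀ @hGR₁ @hGR₂ @hGR₃ @AG hHD hI h₁ h₃ V c hV,
        gen_mem_totalKT @G @hG @hGR @η @hη @hηc @hGR₀ @hGR₁ @hGR₂ @hGR₃ @AG hHD hI h₁ h₃ h hA @μ V c hV hg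
          (hcorr_total @G @hG @hGR @η @hη @hηc @hGR₀ @hGR₁ @hGR₂ @hGR₃ @AG hHD hI h₁ h₃ V c hV)
          (hW_total @G @hG @hGR @η @hη @hηc @hGR₀ @hGR₁ @hGR₂ @hGR₃ @AG hHD hI h₁ h₃ h hA @μ c hc) hAw DT,
        hU₂, hU₃⟩ : Real34GuardedResidual @G @hG @hGR @η @hη @hηc @hGR₀ @hGR₁ @hGR₂ @hGR₃ @AG hHD hI h₁ h₃ h hA @μ V c hV hg).toJunctions).toJunctions.funBridge
      (Model.modelAxiomsPerL hHD hI h₃ h₁).pull_comp (Model.modelAxiomsPerL hHD hI h₃ h₁).pull_cup (Model.modelAxiomsPerL hHD hI h₃ h₁).pull_hodge⟩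

/-- **Row `real34` PER CONTEXT under the guard, from the (34) CENSUS SIDE of the context** — the route of record: `CS` = mc-binder-2's (34) census
core of the context at the W pin (the object that also discharges E's `hyp34`) ⊕ the wedge decomposition `hwedge` of its inserted printed vectors
over `adm₃₄`-admissible frames of lines 2, 3 of the guarded S pin.  Hypotheses at the context only: the guard `hg`, `hc : GoodCtx`, regime `hV`,
`hAw` at `k = 2, 3`, C3₂,₃ `hU₂ hU₃`, `CS`. -/
theorem real34_totalKSAt (hg : G V c)
    (hc : (pinT hHD hI h₁ h₃ h hA (Gen12Pins.Wg @hGR @η @hη @hηc @Gen12Pins.τSyl @Gen12Pins.TSyl @Gen12Pins.hTSyl) (SInstance.SGP @G @hG @hGR @η @hη @hηc @hGR₀ @hGR₁ @hGR₂ @hGR₃ @AG) μ).GoodCtx ι₁ c)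
    (hAw : ∀ k : Fin 4, k = 2 ∨ k = 3 → (AG V c hg k).w = ⇑(archWeight L (μ c k)))
    (hU₂ : ∀ Γ : Level V, (pinT hHD hI h₁ h₃ h hA (Gen12Pins.Wg @hGR @η @hη @hηc @Gen12Pins.τSyl @Gen12Pins.TSyl @Gen12Pins.hTSyl) (SInstance.SGP @G @hG @hGR @η @hη @hηc @hGR₀ @hGR₁ @hGR₂ @hGR₃ @AG) μ).Theta V c 2 Γ ⊆ (picardCMUniverse hHD hI h₁ h₃).Uiso Γ c.K (c.Ψ 2) c.σ)
    (hU₃ : ∀ Γ : Level V, (pinT hHD hI h₁ h₃ h hA (Gen12Pins.Wg @hGR @η @hη @hηc @Gen12Pins.τSyl @Gen12Pins.TSyl @Gen12Pins.hTSyl) (SInstance.SGP @G @hG @hGR @η @hη @hηc @hGR₀ @hGR₁ @hGR₂ @hGR₃ @AG) μ).Theta V c 3 Γ ⊆ (picardCMUniverse hHD hI h₁ h₃).Uiso Γ c.K (c.Ψ 3) c.σ)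
    (CS : Real34CensusSide @G @hG @hGR @η @hη @hηc @hGR₀ @hGR₁ @hGR₂ @hGR₃ @AG hHD hI h₁ h₃ @μ V c hV) :
    Nonempty ((pinT hHD hI h₁ h₃ h hA (Gen12Pins.Wg @hGR @η @hη @hηc @Gen12Pins.τSyl @Gen12Pins.TSyl @Gen12Pins.hTSyl) (SInstance.SGP @G @hG @hGR @η @hη @hηc @hGR₀ @hGR₁ @hGR₂ @hGR₃ @AG) μ).Real34FunBridge V c) :=
  ⟨((⟨hcorr_total @G @hG @hGR @η @hη @hηc @hGR₀ @hGR₁ @hGR₂ @hGR₃ @AG hHD hI h₁ h₃ V c hV,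
        gen_mem_totalKS @G @hG @hGR @η @hη @hηc @hGR₀ @hGR₁ @hGR₂ @hGR₃ @AG hHD hI h₁ h₃ h hA @μ V c hV hg
          (hcorr_total @G @hG @hGR @η @hη @hηc @hGR₀ @hGR₁ @hGR₂ @hGR₃ @AG hHD hI h₁ h₃ V c hV)
          (hW_total @G @hG @hGR @η @hη @hηc @hGR₀ @hGR₁ @hGR₂ @hGR₃ @AG hHD hI h₁ h₃ h hA @μ c hc) hAw CS,
        hU₂, hU₃⟩ : Real34GuardedResidual @G @hG @hGR @η @hη @hηc @hGR₀ @hGR₁ @hGR₂ @hGR₃ @AG hHD hI h₁ h₃ h hA @μ V c hV hg).toJunctions).toJunctions.funBridge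
      (Model.modelAxiomsPerL hHD hI h₃ h₁).pull_comp (Model.modelAxiomsPerL hHD hI h₃ h₁).pull_cup (Model.modelAxiomsPerL hHD hI h₃ h₁).pull_hodge⟩

end Context34

end Gen12PinsP

end HodgeCM.Model

end
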